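import Summits.QuantumFields.YangMills.Theorems.AllWindowsColdBoxBoxHighLineRestrictionSetCum4Slots
import Summits.QuantumFields.YangMills.Theorems.AllWindowsColdBoxBoxHighLineTiltUParitySizes
import Summits.QuantumFields.YangMills.Theorems.AllWindowsColdBoxBoxHighLinePlaqCostSizesOnD
import Summits.QuantumFields.YangMills.Theorems.AllWindowsColdBoxBoxHighLineGaussCovMainReduction

/-!
# U5 K4′(b), row R5: the EVEN-TILT slot `κ₄,₀^{μ_{D′}}(c_x, c_y; Uᵉ, Uᵉ)` by «sup × L²»

Free-hands helper of LEAD ym-line-sfw-p2 g78 for Steps D–E of the NEXT rung U5 (`stub_landauThirdOrder`, LINE-20, ⟨stmt-QuantumFields-24336⟩),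
row R5 of the K4′(b) term table (`ym-idea-1/g78-K4PRIME-TERM-TABLE.md`): the slot of the fourth cumulant at `t = 0` in which the tilt enters only through its
EVEN part `Uᵉ(a) := (tiltU a + tiltU(−a))/2` is small by the elementary «sup × variance» bound — no parity, no Wick:

* `Tilt.abs_tiltExp_le_of_abs_le` — `|E_t G| ≤ B` for `|G| ≤ B`;
* ★ `Tilt.abs_tiltCum4_zero_le_sup_mul_var` (abstract, any finite measure) — for bounded measurable `W, X, Y` and ANY constant `b`:
  `|κ₄,₀(X,Y;W)| ≤ 16·B_X·B_Y·E[(W − b)²]` (`κ₄,₀ = E[X̃ỸW̃²] − E[X̃Ỹ]E[W̃²] − 2E[X̃W̃]E[ỸW̃]`, `|X̃| ≤ 2B_X`, Cauchy–Schwarz on the last pair, re-centring);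
* ★ `GaussRestrict.abs_tiltCum4_muSet_zero_le_sup_mul_sq` — the same over `μ_D := (volume.restrict D).withDensity (ofReal ∘ gaussWeight β H)` for observables
  bounded ON `D` only, in Gaussian letters: `E₀[1 − 1_D] ≤ τ ≤ 1/2 ⇒ |κ₄,₀^{μ_D}(X,Y;W)| ≤ 32·B_X·B_Y·E₀[1_D·(W − b)²]`;
* ★★ `GaussNormalForm.abs_tiltCum4_muSet_chartPlaqCost_tiltUEven_le` — ROW R5 BY NAME: for `H ≥ 1`, `H⁴ ≤ β`, `0 ≤ s ≤ 1`, `s·H² ≤ c₀`, a measurable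
  SYMMETRIC `D ⊆ smallField H s` carrying a bound `sup_D |tiltU| ≤ K`, and `E₀[1 − 1_D] ≤ τ ≤ 1/2`:
  `|κ₄,₀^{μ_D}(chartPlaqCost x, chartPlaqCost y; Uᵉ)| ≤ C·(1+log H)^m·s⁴·(H⁸/β² + H¹²s⁶ + H⁸s⁸)`
  (sup ✓`TiltSup.abs_chartPlaqCost_le` = `116 s²`; variance numerator ✓13K-U parity size `gaussAvg_sfInd_mul_sq_tiltU_even_sub_le`, monotone through `1_D ≤ sfInd`).
  In the HIGH-window letters (`s = β^{−1/2+κ₃}`, `H ≤ β^θ+1`) the relative size `×β²H⁸` is `H¹⁶β^{−2+4κ₃} + H²⁰β^{−3+10κ₃} + H¹⁶β^{−4+12κ₃}` (·polylog):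
  exponent rows `8θ+2κ₃<1`, `20θ+10κ₃<3`, `16θ+12κ₃<4` — all strict at `κ₃ = 1/8 − θ/4`, `θ < 1/10`.

No definitions; standard axioms.  HONEST LABEL: helper-grade U5 prep; U5, ⟨24004⟩, ⟨24336⟩ remain OPEN; route AllWindowsColdBox is DRAFT; no crux, rung or summit
is proved; **the Yang–Mills mass gap is NOT proved by this file; no summit is proved by a line.**
-/

set_option autoImplicit false

noncomputable section

open MeasureTheory Set
open Literature.Probability.LatticeModels (Site)

namespace Summit.QuantumFields.YangMills.Theorems.AllWindowsColdBoxBoxHighLine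

/-! ## §1 Abstract layer -/

namespace Tilt

variable {Ω : Type*} [MeasurableSpace Ω] {μ : Measure Ω}

/-- `|E_t G| ≤ B` whenever `|G| ≤ B` pointwise (`U` bounded measurable, `μ ≠ 0` finite). -/
theorem abs_tiltExp_le_of_abs_le [IsFiniteMeasure μ] [NeZero μ] {U G : Ω → ℝ} {BU B : ℝ} (hU : Measurable U) (hUb : ∀ x, |U x| ≤ BU)
    (hGb : ∀ x, |G x| ≤ B) (t : ℝ) : |tiltExp μ U t G| ≤ B := by
  haveI := isProbabilityMeasure_tilted_mul (μ := μ) hU hUb t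
  rw [tiltExp_eq_integral_tilted, ← Real.norm_eq_abs]
  refine (norm_integral_le_of_norm_le_const (Filter.Eventually.of_forall fun x => ?_)).trans (le_of_eq (by rw [probReal_univ, mul_one]))
  rw [Real.norm_eq_abs]; exact hGb x

/-- ★ **«sup × variance» bound on the fourth cumulant at `t = 0`**: for bounded measurable `W X Y` and any constant `b`,
`|κ₄,₀(X,Y;W)| ≤ 16·B_X·B_Y·E[(W − b)²]` (all expectations `E = E_0^{μ}`). -/
theorem abs_tiltCum4_zero_le_sup_mul_var [IsFiniteMeasure μ] [NeZero μ] {W X Y : Ω → ℝ} {BW BX BY : ℝ} (hW : Measurable W) (hX : Measurable X)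
    (hY : Measurable Y) (hWb : ∀ x, |W x| ≤ BW) (hXb : ∀ x, |X x| ≤ BX) (hYb : ∀ x, |Y x| ≤ BY) (b : ℝ) :
    |tiltCum4 μ W 0 X Y| ≤ 16 * BX * BY * tiltExp μ W 0 (fun x => (W x - b) ^ 2) := by
  rw [GaussRestrict.tiltCum4_zero_eq_quad μ W W X Y]
  set mX := tiltExp μ W 0 X with hmX
  set mY := tiltExp μ W 0 Y with hmY
  set mW := tiltExp μ W 0 W with hmW
  have hBX : 0 ≤ BX := (abs_nonneg _).trans (abs_tiltExp_le_of_abs_le (μ := μ) hW hWb hXb 0)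
  have hBY : 0 ≤ BY := (abs_nonneg _).trans (abs_tiltExp_le_of_abs_le (μ := μ) hW hWb hYb 0)
  have bmX : |mX| ≤ BX := abs_tiltExp_le_of_abs_le (μ := μ) hW hWb hXb 0
  have bmY : |mY| ≤ BY := abs_tiltExp_le_of_abs_le (μ := μ) hW hWb hYb 0
  have bmW : |mW| ≤ BW := abs_tiltExp_le_of_abs_le (μ := μ) hW hWb hWb 0
  -- centred observables and their bounds
  have mXc : Measurable fun x => X x - mX := hX.sub measurable_const
  have mYc : Measurable fun x => Y x - mY := hY.sub measurable_const
  have mWc : Measurable fun x => W x - mW := hW.sub measurable_const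
  have bXc : ∀ x, |X x - mX| ≤ 2 * BX := fun x => (abs_sub _ _).trans (by linarith [hXb x])
  have bYc : ∀ x, |Y x - mY| ≤ 2 * BY := fun x => (abs_sub _ _).trans (by linarith [hYb x])
  have bWc : ∀ x, |W x - mW| ≤ 2 * BW := fun x => (abs_sub _ _).trans (by linarith [hWb x])
  have mWc2 : Measurable fun x => (W x - mW) ^ 2 := mWc.pow_const 2
  have bWc2 : ∀ x, |(W x - mW) ^ 2| ≤ (2 * BW) ^ 2 := fun x => by rw [abs_pow]; exact pow_le_pow_left₀ (abs_nonneg _) (bWc x) 2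
  -- the variance `V ≥ 0`
  set V := tiltExp μ W 0 (fun x => (W x - mW) ^ 2) with hV
  have hV0 : 0 ≤ V := by
    haveI := isProbabilityMeasure_tilted_mul (μ := μ) hW hWb 0
    rw [hV, tiltExp_eq_integral_tilted]; exact integral_nonneg fun x => sq_nonneg _
  -- T1: `|E[X̃ỸW̃²]| ≤ 4·B_X·B_Y·V`
  have mT1 : Measurable fun x => (X x - mX) * (Y x - mY) * (W x - mW) ^ 2 := (mXc.mul mYc).mul mWc2
  have bT1 : ∀ x, |(X x - mX) * (Y x - mY) * (W x - mW) ^ 2| ≤ 2 * BX * (2 * BY) * (2 * BW) ^ 2 := fun x => by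
    rw [abs_mul, abs_mul]
    exact mul_le_mul (mul_le_mul (bXc x) (bYc x) (abs_nonneg _) (by linarith)) (bWc2 x) (abs_nonneg _) (by positivity)
  have pT1 : ∀ x, |(X x - mX) * (Y x - mY) * (W x - mW) ^ 2| ≤ 4 * BX * BY * (W x - mW) ^ 2 := fun x => by
    rw [abs_mul, abs_mul, abs_of_nonneg (sq_nonneg (W x - mW))]
    have := mul_le_mul (bXc x) (bYc x) (abs_nonneg _) (by linarith)
    nlinarith [sq_nonneg (W x - mW), abs_nonneg (X x - mX), abs_nonneg (Y x - mY)]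
  have mG : Measurable fun x => 4 * BX * BY * (W x - mW) ^ 2 := mWc2.const_mul _
  have bG : ∀ x, |4 * BX * BY * (W x - mW) ^ 2| ≤ 4 * BX * BY * (2 * BW) ^ 2 := fun x => by
    rw [abs_mul, abs_of_nonneg (by positivity : (0 : ℝ) ≤ 4 * BX * BY)]
    exact mul_le_mul_of_nonneg_left (bWc2 x) (by positivity)
  have hT1 : |tiltExp μ W 0 (fun x => (X x - mX) * (Y x - mY) * (W x - mW) ^ 2)| ≤ 4 * BX * BY * V := by
    have up := tiltExp_mono (μ := μ) mT1 mG bT1 bG W 0 fun x => (abs_le.mp (pT1 x)).2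
    have mnG : Measurable fun x => -(4 * BX * BY * (W x - mW) ^ 2) := mG.neg
    have bnG : ∀ x, |-(4 * BX * BY * (W x - mW) ^ 2)| ≤ 4 * BX * BY * (2 * BW) ^ 2 := fun x => by rw [abs_neg]; exact bG x
    have lo := tiltExp_mono (μ := μ) mnG mT1 bnG bT1 W 0 fun x => (abs_le.mp (pT1 x)).1
    have e1 : tiltExp μ W 0 (fun x => 4 * BX * BY * (W x - mW) ^ 2) = 4 * BX * BY * V := tiltExp_const_mul W 0 _ _
    have e2 : tiltExp μ W 0 (fun x => -(4 * BX * BY * (W x - mW) ^ 2)) = -(4 * BX * BY * V) := by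
      rw [← e1, ← neg_one_mul, ← tiltExp_const_mul]; exact congrArg _ (funext fun x => by ring)
    rw [e1] at up; rw [e2] at lo
    exact abs_le.mpr ⟨lo, up⟩
  -- T2: `|E[X̃Ỹ]| ≤ 4·B_X·B_Y`
  have bT2p : ∀ x, |(X x - mX) * (Y x - mY)| ≤ 2 * BX * (2 * BY) := fun x => by
    rw [abs_mul]; exact mul_le_mul (bXc x) (bYc x) (abs_nonneg _) (by linarith)
  have hT2 : |tiltExp μ W 0 (fun x => (X x - mX) * (Y x - mY))| ≤ 4 * BX * BY :=
    (abs_tiltExp_le_of_abs_le (μ := μ) hW hWb bT2p 0).trans (le_of_eq (by ring))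
  -- T3: `|E[X̃W̃]| ≤ 2·B_X·√V`, `|E[ỸW̃]| ≤ 2·B_Y·√V`
  have cs : ∀ {P : Ω → ℝ} {BP : ℝ}, Measurable P → (∀ x, |P x| ≤ 2 * BP) → 0 ≤ BP →
      |tiltExp μ W 0 (fun x => P x * (W x - mW))| ≤ 2 * BP * Real.sqrt V := by
    intro P BP mP bP hBP
    have h := abs_tiltExp_mul_le (μ := μ) mP mWc bP bWc W 0
    refine h.trans (mul_le_mul_of_nonneg_right ?_ (Real.sqrt_nonneg _))
    have bP2 : ∀ x, |P x ^ 2| ≤ (2 * BP) ^ 2 := fun x => by rw [abs_pow]; exact pow_le_pow_left₀ (abs_nonneg _) (bP x) 2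
    have h2 : tiltExp μ W 0 (fun x => P x ^ 2) ≤ (2 * BP) ^ 2 := (le_abs_self _).trans (abs_tiltExp_le_of_abs_le (μ := μ) hW hWb bP2 0)
    calc Real.sqrt (tiltExp μ W 0 (fun x => P x ^ 2)) ≤ Real.sqrt ((2 * BP) ^ 2) := Real.sqrt_le_sqrt h2
      _ = 2 * BP := Real.sqrt_sq (by linarith)
  have hT3x := cs mXc bXc hBX
  have hT3y := cs mYc bYc hBY
  -- assemble
  have hVV : Real.sqrt V * Real.sqrt V = V := Real.mul_self_sqrt hV0
  have key : |tiltExp μ W 0 (fun x => (X x - mX) * (Y x - mY) * (W x - mW) ^ 2) -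
        tiltExp μ W 0 (fun x => (X x - mX) * (Y x - mY)) * V -
        2 * (tiltExp μ W 0 (fun x => (X x - mX) * (W x - mW)) * tiltExp μ W 0 (fun x => (Y x - mY) * (W x - mW)))| ≤ 16 * BX * BY * V := by
    have h3 : |tiltExp μ W 0 (fun x => (X x - mX) * (W x - mW)) * tiltExp μ W 0 (fun x => (Y x - mY) * (W x - mW))| ≤
        2 * BX * Real.sqrt V * (2 * BY * Real.sqrt V) := by
      rw [abs_mul]; exact mul_le_mul hT3x hT3y (abs_nonneg _) (by positivity)
    have h3' : 2 * BX * Real.sqrt V * (2 * BY * Real.sqrt V) = 4 * BX * BY * V := by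
      rw [show 2 * BX * Real.sqrt V * (2 * BY * Real.sqrt V) = 4 * BX * BY * (Real.sqrt V * Real.sqrt V) by ring, hVV]
    have h2 : |tiltExp μ W 0 (fun x => (X x - mX) * (Y x - mY)) * V| ≤ 4 * BX * BY * V := by
      rw [abs_mul, abs_of_nonneg hV0]; exact mul_le_mul_of_nonneg_right hT2 hV0
    calc _ ≤ |tiltExp μ W 0 (fun x => (X x - mX) * (Y x - mY) * (W x - mW) ^ 2) - tiltExp μ W 0 (fun x => (X x - mX) * (Y x - mY)) * V| +
          |2 * (tiltExp μ W 0 (fun x => (X x - mX) * (W x - mW)) * tiltExp μ W 0 (fun x => (Y x - mY) * (W x - mW)))| := abs_sub _ _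
      _ ≤ (|tiltExp μ W 0 (fun x => (X x - mX) * (Y x - mY) * (W x - mW) ^ 2)| + |tiltExp μ W 0 (fun x => (X x - mX) * (Y x - mY)) * V|) +
          2 * |tiltExp μ W 0 (fun x => (X x - mX) * (W x - mW)) * tiltExp μ W 0 (fun x => (Y x - mY) * (W x - mW))| := by
          rw [abs_mul, abs_two]; exact add_le_add (abs_sub _ _) le_rfl
      _ ≤ (4 * BX * BY * V + 4 * BX * BY * V) + 2 * (4 * BX * BY * V) := by
          refine add_le_add (add_le_add hT1 h2) (mul_le_mul_of_nonneg_left (h3.trans (le_of_eq h3')) zero_le_two)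
      _ = 16 * BX * BY * V := by ring
  refine key.trans (mul_le_mul_of_nonneg_left ?_ (by positivity))
  exact tiltExp_centredSq_le (μ := μ) hW hW hWb hWb 0 b

end Tilt

/-! ## §2 Over `μ_D` for a general measurable `D`, in Gaussian letters -/

namespace GaussRestrict

variable {H : ℕ} {β : ℝ}

/-- ★ **«sup × L²» bound on `κ₄,₀` over `μ_D`**: `E₀[1 − 1_D] ≤ τ ≤ 1/2`; `X Y W` measurable, bounded by `B_X, B_Y, B_W` ON `D`; then for ANY constant `b`:
`|κ₄,₀^{μ_D}(X,Y;W)| ≤ 32·B_X·B_Y·E₀[1_D·(W − b)²]`. -/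
theorem abs_tiltCum4_muSet_zero_le_sup_mul_sq (hβ : 0 < β) {D : Set (LandauFree H → E3)} (hDm : MeasurableSet D) {τ : ℝ}
    (hτ : gaussAvg β H (fun a => 1 - D.indicator (fun _ => (1 : ℝ)) a) ≤ τ) (hτ2 : τ ≤ 1 / 2)
    {X Y W : (LandauFree H → E3) → ℝ} {BX BY BW : ℝ} (hBX : 0 ≤ BX) (hBY : 0 ≤ BY) (hBW : 0 ≤ BW)
    (mX : Measurable X) (mY : Measurable Y) (mW : Measurable W)
    (bX : ∀ a ∈ D, |X a| ≤ BX) (bY : ∀ a ∈ D, |Y a| ≤ BY) (bW : ∀ a ∈ D, |W a| ≤ BW) (b : ℝ) :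
    |Tilt.tiltCum4 ((((volume : Measure (LandauFree H → E3)).restrict D).withDensity fun a => ENNReal.ofReal (gaussWeight β H a))) W 0 X Y| ≤
      32 * BX * BY * gaussAvg β H (fun a => D.indicator (fun _ => (1 : ℝ)) a * (W a - b) ^ 2) := by
  set μD : Measure (LandauFree H → E3) := (((volume : Measure (LandauFree H → E3)).restrict D).withDensity fun a => ENNReal.ofReal (gaussWeight β H a))
    with hμD
  have hD := integral_indicator_mul_gaussWeight_pos hβ hDm hτ hτ2
  haveI := isFiniteMeasure_muSet hβ D
  haveI := neZero_muSet hβ hDm hD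
  have mI : Measurable (D.indicator (fun _ => (1 : ℝ))) := measurable_const.indicator hDm
  -- truncations, equal to the observables `μ_D`-a.e.
  have aX := ae_muSet_eq_indicator_mul β hDm X
  have aY := ae_muSet_eq_indicator_mul β hDm Y
  have aW := ae_muSet_eq_indicator_mul β hDm W
  set X' : (LandauFree H → E3) → ℝ := fun a => D.indicator (fun _ => (1 : ℝ)) a * X a with hX'
  set Y' : (LandauFree H → E3) → ℝ := fun a => D.indicator (fun _ => (1 : ℝ)) a * Y a with hY'
  set W' : (LandauFree H → E3) → ℝ := fun a => D.indicator (fun _ => (1 : ℝ)) a * W a with hW'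
  have mX' : Measurable X' := mI.mul mX
  have mY' : Measurable Y' := mI.mul mY
  have mW' : Measurable W' := mI.mul mW
  have bX' : ∀ a, |X' a| ≤ BX := abs_indicator_one_mul_le hBX bX
  have bY' : ∀ a, |Y' a| ≤ BY := abs_indicator_one_mul_le hBY bY
  have bW' : ∀ a, |W' a| ≤ BW := abs_indicator_one_mul_le hBW bW
  rw [Tilt.tiltCum4_congr_ae aW aX aY 0]
  have h := Tilt.abs_tiltCum4_zero_le_sup_mul_var (μ := μD) mW' mX' mY' bW' bX' bY' b
  refine h.trans ?_
  -- `E^{μ_D}[(W' − b)²] = E^{μ_D}[1_D (W − b)²] ≤ 2·E₀[1_D (W − b)²]`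
  have eq1 : Tilt.tiltExp μD W' 0 (fun a => (W' a - b) ^ 2) = Tilt.tiltExp μD W' 0 (fun a => D.indicator (fun _ => (1 : ℝ)) a * (W a - b) ^ 2) := by
    refine tiltExp_muSet_congr_on β hDm W' 0 fun a ha => ?_
    simp only [hW', Set.indicator_of_mem ha, one_mul]
  have h0 : 0 ≤ fun a => D.indicator (fun _ => (1 : ℝ)) a * (W a - b) ^ 2 := fun a => mul_nonneg (indicator_one_nonneg_le_one D a).1 (sq_nonneg _)
  have hI : Integrable fun a => D.indicator (fun _ => (1 : ℝ)) a * (W a - b) ^ 2 * gaussWeight β H a :=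
    Tilt.integrable_bdd_mul_gaussWeight H hβ (mI.mul ((mW.sub measurable_const).pow_const 2)) (C := (BW + |b|) ^ 2) fun a => by
      by_cases ha : a ∈ D
      · rw [Set.indicator_of_mem ha, one_mul, abs_pow]
        exact pow_le_pow_left₀ (abs_nonneg _) ((abs_sub _ _).trans (add_le_add (bW a ha) le_rfl)) 2
      · rw [Set.indicator_of_notMem ha, zero_mul, abs_zero]; positivity
  have h2 := tiltExp_muSet_zero_le_two_mul_gaussAvg hβ hDm hτ hτ2 W' h0 hI
  rw [eq1] at *
  have h16 : 0 ≤ 16 * BX * BY := by positivity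
  calc 16 * BX * BY * Tilt.tiltExp μD W' 0 (fun a => D.indicator (fun _ => (1 : ℝ)) a * (W a - b) ^ 2)
      ≤ 16 * BX * BY * (2 * gaussAvg β H (fun a => D.indicator (fun _ => (1 : ℝ)) a * (W a - b) ^ 2)) := mul_le_mul_of_nonneg_left h2 h16
    _ = _ := by ring

end GaussRestrict

/-! ## §3 Row R5 by name -/

namespace GaussNormalForm

/-- ★★ **K4′(b) row R5 — the even-tilt slot of `κ₄,₀` over `μ_D` in β-letters.**  There are `C ≥ 0`, `c₀ > 0`, `m` such that for `H ≥ 1`, `H⁴ ≤ β`, `0 ≤ s ≤ 1`,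
`s·H² ≤ c₀`, every measurable SYMMETRIC `D ⊆ smallField H s` with `sup_D |tiltU| ≤ K` (`K ≥ 0`) and `E₀[1 − 1_D] ≤ τ ≤ 1/2`, and all base points `x y`:
`|κ₄,₀^{μ_D}(chartPlaqCost x, chartPlaqCost y; Uᵉ)| ≤ C·(1+log H)^m·s⁴·(H⁸/β² + H¹²s⁶ + H⁸s⁸)`, `Uᵉ(a) = (tiltU a + tiltU(−a))/2`. -/
theorem abs_tiltCum4_muSet_chartPlaqCost_tiltUEven_le :
    ∃ C c₀ : ℝ, ∃ m : ℕ, 0 ≤ C ∧ 0 < c₀ ∧ ∀ H : ℕ, 1 ≤ H → ∀ β : ℝ, (H : ℝ) ^ 4 ≤ β → ∀ s : ℝ, 0 ≤ s → s ≤ 1 → s * (H : ℝ) ^ 2 ≤ c₀ →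
      ∀ D : Set (LandauFree H → E3), MeasurableSet D → D ⊆ smallField H s → (∀ a, -a ∈ D ↔ a ∈ D) →
      ∀ K : ℝ, 0 ≤ K → (∀ a ∈ D, |tiltU β H a| ≤ K) →
      ∀ τ : ℝ, gaussAvg β H (fun a => 1 - D.indicator (fun _ => (1 : ℝ)) a) ≤ τ → τ ≤ 1 / 2 → ∀ x y : Site 4,
        |Tilt.tiltCum4 ((((volume : Measure (LandauFree H → E3)).restrict D).withDensity fun a => ENNReal.ofReal (gaussWeight β H a)))
            (fun a => (tiltU β H a + tiltU β H (-a)) / 2) 0 (chartPlaqCost H x 1 2) (chartPlaqCost H y 1 2)| ≤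
          C * (1 + Real.log H) ^ m * s ^ 4 * ((H : ℝ) ^ 8 / β ^ 2 + (H : ℝ) ^ 12 * s ^ 6 + (H : ℝ) ^ 8 * s ^ 8) := by
  obtain ⟨CU, c₀, m, hc₀, hU⟩ := gaussAvg_sfInd_mul_sq_tiltU_even_sub_le
  obtain ⟨CT, cT, mT, hcT, hT⟩ := TiltSup.abs_tiltU_le_of ghostTaylor
  -- `CU ≥ 0`, read off at `H = 1`, `β = 1`, `s = 0`
  have hCU : 0 ≤ CU := by
    obtain ⟨b, hb⟩ := hU 1 le_rfl 1 (by norm_num) 0 le_rfl zero_le_one (by simpa using hc₀.le)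
    have h0 : 0 ≤ gaussAvg 1 1 (fun a => sfInd 1 0 a * ((tiltU 1 1 a + tiltU 1 1 (-a)) / 2 - b) ^ 2) :=
      EdgeChartGaussian.gaussAvg_nonneg 1 one_pos fun a => mul_nonneg (TiltSup.sfInd_nonneg_le_one (H := 1) 0 a).1 (sq_nonneg _)
    have := h0.trans hb
    norm_num at this
    linarith
  refine ⟨32 * 116 * 116 * CU, min c₀ cT, m, by positivity, lt_min hc₀ hcT, fun H hH β hβ s hs0 hs1 hsH D hDm hDs hsym K hK hUK τ hτ hτ2 x y => ?_⟩
  have hH1 : (1 : ℝ) ≤ H := by exact_mod_cast hH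
  have hβ1 : 1 ≤ β := (one_le_pow₀ (M₀ := ℝ) hH1 (n := 4)).trans hβ
  have hβ0 : 0 < β := by linarith
  obtain ⟨b, hb⟩ := hU H hH β hβ s hs0 hs1 (hsH.trans (min_le_left _ _))
  have hTs := hT H hH β s hs0 hs1 (hsH.trans (min_le_right _ _))
  -- the even part, kept opaque
  obtain ⟨W, hW⟩ : ∃ W : (LandauFree H → E3) → ℝ, ∀ a, W a = (tiltU β H a + tiltU β H (-a)) / 2 := ⟨_, fun _ => rfl⟩
  have hWfun : (fun a => (tiltU β H a + tiltU β H (-a)) / 2) = W := funext fun a => (hW a).symm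
  have hb' : gaussAvg β H (fun a => sfInd H s a * (W a - b) ^ 2) ≤ CU * (1 + Real.log H) ^ m * ((H : ℝ) ^ 8 / β ^ 2 + (H : ℝ) ^ 12 * s ^ 6 + (H : ℝ) ^ 8 * s ^ 8) := by
    simpa only [hW] using hb
  rw [hWfun]
  -- bounds on `D` and on `smallField s`
  have bX : ∀ a ∈ D, |chartPlaqCost H x 1 2 a| ≤ 116 * s ^ 2 := fun a ha => TiltSup.abs_chartPlaqCost_le hs0 hs1 (hDs ha) x 1 2
  have bY : ∀ a ∈ D, |chartPlaqCost H y 1 2 a| ≤ 116 * s ^ 2 := fun a ha => TiltSup.abs_chartPlaqCost_le hs0 hs1 (hDs ha) y 1 2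
  have bW : ∀ a ∈ D, |W a| ≤ K := fun a ha => by
    have h1 := hUK a ha
    have h2 := hUK (-a) ((hsym a).2 ha)
    rw [hW, abs_div, abs_two]
    linarith [abs_add_le (tiltU β H a) (tiltU β H (-a))]
  set T : ℝ := CT * (1 + Real.log H) ^ mT * (|β| * (H : ℝ) ^ 4 * s ^ 3 + (H : ℝ) ^ 6 * s ^ 2) with hTdef
  have bWs : ∀ a ∈ smallField H s, |W a| ≤ T := fun a ha => by
    have h1 := hTs a ha
    have h2 := hTs (-a) ((EdgeChartGaussian.neg_mem_smallField_iff s a).2 ha)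
    rw [hW, abs_div, abs_two]
    linarith [abs_add_le (tiltU β H a) (tiltU β H (-a))]
  have mW : Measurable W := by
    rw [← hWfun]; exact ((measurable_tiltU β H).add ((measurable_tiltU β H).comp measurable_neg)).div_const 2
  have h := GaussRestrict.abs_tiltCum4_muSet_zero_le_sup_mul_sq hβ0 hDm hτ hτ2 (by positivity) (by positivity) hK
    (EdgeChartGaussian.measurable_chartPlaqCost H x 1 2) (EdgeChartGaussian.measurable_chartPlaqCost H y 1 2) mW bX bY bW b
  refine h.trans ?_
  -- `E₀[1_D (W − b)²] ≤ E₀[sfInd·(W − b)²] ≤ RU`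
  have hsf := fun a : LandauFree H → E3 => TiltSup.sfInd_nonneg_le_one (H := H) s a
  have hle : ∀ a, D.indicator (fun _ => (1 : ℝ)) a * (W a - b) ^ 2 ≤ sfInd H s a * (W a - b) ^ 2 := fun a => by
    refine mul_le_mul_of_nonneg_right ?_ (sq_nonneg _)
    by_cases ha : a ∈ D
    · rw [Set.indicator_of_mem ha, TiltSup.sfInd_of_mem (hDs ha)]
    · rw [Set.indicator_of_notMem ha]; exact (hsf a).1
  have hI : Integrable fun a => sfInd H s a * (W a - b) ^ 2 * gaussWeight β H a :=
    Tilt.integrable_sfInd_mul H hβ0 s ((mW.sub measurable_const).pow_const 2) (sq_nonneg (T + |b|)) fun a ha => by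
      rw [abs_pow]; exact pow_le_pow_left₀ (abs_nonneg _) ((abs_sub _ _).trans (add_le_add (bWs a ha) le_rfl)) 2
  have hmono := EdgeChartGaussian.gaussAvg_mono_of_nonneg H hβ0
    (fun a => mul_nonneg (GaussRestrict.indicator_one_nonneg_le_one D a).1 (sq_nonneg _)) hle hI
  calc 32 * (116 * s ^ 2) * (116 * s ^ 2) * gaussAvg β H (fun a => D.indicator (fun _ => (1 : ℝ)) a * (W a - b) ^ 2)
      ≤ 32 * (116 * s ^ 2) * (116 * s ^ 2) * (CU * (1 + Real.log H) ^ m * ((H : ℝ) ^ 8 / β ^ 2 + (H : ℝ) ^ 12 * s ^ 6 + (H : ℝ) ^ 8 * s ^ 8)) :=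
        mul_le_mul_of_nonneg_left (hmono.trans hb') (by positivity)
    _ = _ := by ring

end GaussNormalForm

end Summit.QuantumFields.YangMills.Theorems.AllWindowsColdBoxBoxHighLine

end
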